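/- Width seat `ym-line-cbag-p1-w3` (prover-ym-line-cbag-p1-w3-g5-0) of the sibling line `ColdBoxAllGroups` (planner-of-record ym-idea-2):
a helper for the open crux `BulkWindowSU2` (stmt-QuantumFields-23030) of route `AllWindowsColdBox` — its SMALL-`A` part, from the
`G`-uniform BULK at all small windows (`Theorems/ColdBoxAllGroupsBulkSmallWindows.lean`). -/
import Summits.QuantumFields.YangMills.Theorems.ColdBoxAllGroupsBulkSmallWindows
import Summits.QuantumFields.YangMills.Theorems.AllWindowsColdBoxBoxAllWindowsSU22SmallWindows

/-!
# Crux `BulkWindowSU2` (stmt-QuantumFields-23030, route `AllWindowsColdBox`): the small exponents `A ≤ 1/4000` are settled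

`BulkWindowSU2 := ∀ A > 0, ∃ θ, A < θ ∧ θ ≤ 7A ∧ BulkDominatesBox (SU(2), fundamental) A θ` (for every separation exponent `A` SOME box
exponent in the collar `(A, 7A]` transfers the cold-box covariance to the torus states).  The proved BULK theorems of record
(`BulkDominatesColdBoxW_proof` for `SU(2)`, `BulkAllGroups_proof` / `bulkDominatesBox_allGroups_explicit` for every compact simple `G`)
produce the pair `(A, θ) = (θ/20, θ)` only — box exponent twenty times the separation exponent, OUTSIDE the collar `θ ≤ 7A`.  The box-size
transfer `bulkDominatesBox_allGroups_smallWindows` (two-sided one-scale Gaussian domination at both box sizes: the cold-wall covariance at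
separation `⌈β^A⌉` changes by at most a factor `27` between any two boxes `β^θ`, `β^θ'` with `θ, θ' ∈ (A, 1/100]`) frees the box exponent,
and specialised to `G = SU(2)`, `r =` fundamental (`isSimpleCompactGroup_specialUnitaryGroup_holds`, `fundamentalLatticeRep 2`) gives:

* `bulkWindowSU2_allSmallWindows` — for ALL `0 < A ≤ 1/4000` and ALL `A < θ ≤ 1/100`: `BulkDominatesBox (fundamentalRep (Fin 2)) A θ`;
* `bulkWindowSU2_smallWindows` / `bulkWindowSU2_of_le` — hence the crux's body `∃ θ, A < θ ∧ θ ≤ 7A ∧ BulkDominatesBox … A θ` for every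
  `0 < A ≤ 1/4000` (witness `θ = 2A`);
* `boxAndBulkWindowSU2_smallWindows` — with the BOX helper `boxAllWindowsSU22_smallWindows` (lead p1 g7): BOX ∧ BULK of LINE 2 jointly on
  every window `0 < A ≤ 1/4000`, `A < θ ≤ 1/100`;
* `xiSuperPolySU2_smallExponents` — the route's deciding composition (`closes`: window `(2A, θ)`, `massGapPowerDecayOf_of_box`, FLOOR) run on
  the settled windows: `MassGapPowerDecayOf 4 (SU(2), fundamental) A` for every `0 < A ≤ 1/8000` (the target `XiSuperPolySU2` asks this for
  EVERY `A > 0`; for `A ≤ 1/8000` it carries no information beyond the proved uniform exponent `xiPow_uniform`, by monotonicity in `A`).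

What remains OPEN of `BulkWindowSU2` is exactly `A > 1/4000` (boxes `β^θ`, `θ > A > 1/4000` up to `7A`, eventually beyond the one-scale
window `θ ≤ 1/100`: the multi-scale content named in the item).  No sorry; no new definition; standard axioms.  NOT the Yang–Mills mass gap
and not the crux itself: torus-vs-box covariance comparisons in the one-scale weak-coupling window (RECORD-label rung level); no summit
statement is proved.
-/

set_option autoImplicit false

noncomputable section

namespace Summit.QuantumFields.YangMills.Theorems.AllWindowsColdBox

open Literature.MathematicalPhysics.QuantumFieldTheory Literature.MathematicalPhysics.QuantumLattice
open Summit.QuantumFields.YangMills.Theorems.WeakCouplingRates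
open Summit.QuantumFields.YangMills.Theorems.ColdBoxAllGroups

/-- **All small windows of `BulkWindowSU2` at once**: for all `0 < A ≤ 1/4000` and all `A < θ ≤ 1/100`,
`BulkDominatesBox (fundamentalRep (Fin 2)) A θ` — some `η > 0` such that for all large `β`, eventually in the torus size, the `SU(2)` torus
covariance of the `(1,2)`-plaquette cost and its translate by `⌈β^A⌉e₀` is `≥ η ×` the cold-wall box covariance of half-side `⌈β^θ⌉`
(`bulkDominatesBox_allGroups_smallWindows` at `G = SU(2)`, compact simple in the tree sense, `r = fundamentalLatticeRep 2`).  NOT the Clay gap. -/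
theorem bulkWindowSU2_allSmallWindows :
    ∀ A θ : ℝ, 0 < A → A ≤ 1 / 4000 → A < θ → θ ≤ 1 / 100 →
      BulkDominatesBox (G := Matrix.specialUnitaryGroup (Fin 2) ℂ) (fundamentalRep (Fin 2)) A θ :=
  fun _ _ hA hA1 hAθ hθ =>
    bulkDominatesBox_allGroups_smallWindows (Matrix.specialUnitaryGroup (Fin 2) ℂ)
      (isCompactSimpleLieGroup_specialUnitaryGroup isSimpleCompactGroup_specialUnitaryGroup_holds (by norm_num))
      (fundamentalLatticeRep 2) hA hA1 hAθ hθ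

/-- **The crux's collar at small `A`**: for every `0 < A ≤ 1/4000` there is `θ` with `A < θ ≤ 7A` (witness `θ = 2A`) and
`BulkDominatesBox (fundamentalRep (Fin 2)) A θ` — literally the body of `Theses.AllWindowsColdBox.BulkWindowSU2` under the extra hypothesis
`A ≤ 1/4000`.  NOT the Clay gap. -/
theorem bulkWindowSU2_smallWindows :
    ∀ A : ℝ, 0 < A → A ≤ 1 / 4000 → ∃ θ : ℝ, A < θ ∧ θ ≤ 7 * A ∧
      BulkDominatesBox (G := Matrix.specialUnitaryGroup (Fin 2) ℂ) (fundamentalRep (Fin 2)) A θ :=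
  fun A hA hA1 =>
    ⟨2 * A, by linarith, by linarith, bulkWindowSU2_allSmallWindows A (2 * A) hA hA1 (by linarith) (by linarith)⟩

/-- **Every admissible box of the collar works at small `A`**: for `0 < A ≤ 1/4000` and any `θ` with `A < θ ≤ 7A` (automatically
`θ ≤ 7/4000 ≤ 1/100`), `BulkDominatesBox (fundamentalRep (Fin 2)) A θ` — not just one `θ` as the crux asks.  NOT the Clay gap. -/
theorem bulkWindowSU2_of_le :
    ∀ A θ : ℝ, 0 < A → A ≤ 1 / 4000 → A < θ → θ ≤ 7 * A →
      BulkDominatesBox (G := Matrix.specialUnitaryGroup (Fin 2) ℂ) (fundamentalRep (Fin 2)) A θ :=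
  fun A θ hA hA1 hAθ hθ7 => bulkWindowSU2_allSmallWindows A θ hA hA1 hAθ (by linarith)

/-- **BOX ∧ BULK of LINE 2 jointly on every small window**: for `0 < A ≤ 1/4000` and `A < θ ≤ 1/100`,
`(∃ c > 0, BoxTwoPointDomination (fundamentalRep (Fin 2)) A θ c) ∧ BulkDominatesBox (fundamentalRep (Fin 2)) A θ` (BOX: lead p1 g7's
`boxAllWindowsSU22_smallWindows`; BULK: `bulkWindowSU2_allSmallWindows`).  NOT the Clay gap. -/
theorem boxAndBulkWindowSU2_smallWindows :
    ∀ A θ : ℝ, 0 < A → A ≤ 1 / 4000 → A < θ → θ ≤ 1 / 100 →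
      (∃ c : ℝ, 0 < c ∧ BoxTwoPointDomination (G := Matrix.specialUnitaryGroup (Fin 2) ℂ) (fundamentalRep (Fin 2)) A θ c) ∧
        BulkDominatesBox (G := Matrix.specialUnitaryGroup (Fin 2) ℂ) (fundamentalRep (Fin 2)) A θ :=
  fun A θ hA hA1 hAθ hθ =>
    ⟨boxAllWindowsSU22_smallWindows A θ hA hAθ hθ, bulkWindowSU2_allSmallWindows A θ hA hA1 hAθ hθ⟩

/-- **The route's deciding composition on the settled windows**: for every `0 < A ≤ 1/8000`,
`MassGapPowerDecayOf 4 (SU(2), fundamental) A` — every torus-limit state of 4-D `SU(2)` Wilson theory has RP-spectral mass gap `≤ β^{−A}`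
for `β ≥ β₀(A)` (`closes` verbatim: BOX and BULK at the window `(2A, 4A)`, `massGapPowerDecayOf_of_box`, FLOOR `curvatureCorrPowerFloor_proof`).
The target `XiSuperPolySU2` asks this for EVERY `A > 0`; the range `A ≤ 1/8000` adds nothing to the proved uniform exponent
`ColdBoxAllGroups.xiPow_uniform` (monotonicity in `A`) and is recorded only as the composition check of LINE 2 below its open regime.
RECORD-label rung level; NOT the Clay Yang–Mills mass gap. -/
theorem xiSuperPolySU2_smallExponents :
    ∀ A : ℝ, 0 < A → A ≤ 1 / 8000 →
      MassGapPowerDecayOf (G := Matrix.specialUnitaryGroup (Fin 2) ℂ) 4 (fundamentalRep (Fin 2)) A := by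
  intro A hA hA1
  obtain ⟨c, hc, hbox⟩ := boxAllWindowsSU22_smallWindows (2 * A) (4 * A) (by linarith) (by linarith) (by linarith)
  have hbulk := bulkWindowSU2_allSmallWindows (2 * A) (4 * A) (by linarith) (by linarith) (by linarith) (by linarith)
  have h := massGapPowerDecayOf_of_box (G := Matrix.specialUnitaryGroup (Fin 2) ℂ) (fundamentalRep (Fin 2))
    (continuous_fundamentalRep (Fin 2)) (by linarith : (0 : ℝ) < 2 * A) hc hbox hbulk curvatureCorrPowerFloor_proof
  have e : 2 * A / 2 = A := by ring
  rw [e] at h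
  exact h

end Summit.QuantumFields.YangMills.Theorems.AllWindowsColdBox

end
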